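import Literature.NumberTheory.DiophantineGeometry.KroneckerHeightZero
import Mathlib.RingTheory.Polynomial.Chebyshev
import Mathlib.NumberTheory.Height.NumberField
import Mathlib.NumberTheory.NumberField.InfinitePlace.Embeddings
import Mathlib.FieldTheory.IsAlgClosed.Basic
import Mathlib.FieldTheory.SplittingField.Construction
import Mathlib.Analysis.Complex.Basic
import Mathlib.GroupTheory.OrderOfElement
import HarnessLib

set_option linter.dupNamespace false

/-!
# Route `route-ABC-IUTThetaPilot`, support item `GenEllTwo` (stmt-ABC-19679) — helper.
# [GenEll] Thm. 2.1, (ii) ⇒ (i): the menu covering lemma — the INNER (Chebyshev) family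

S. Mochizuki, *Arithmetic elliptic curves in general position*, Math. J. Okayama Univ. **52** (2010)
[cite: MochizukiGenEll2010], proof of Thm. 2.1 p. 12 (number-field-only architecture, package
GENELLTWO-P1ROUTE §4, cell abc-iut).  The INNER family of the depth-2 menu is the Chebyshev family
conjugated to the cusps `{0, 1, ∞}` of `ℙ¹ ∖ {0,1,∞}`:
`g_n(x) := (C_n(4x − 2) + 2)/4`, where `C_n` is the normalised Chebyshev polynomial
(`C_n(w + w⁻¹) = wⁿ + w⁻ⁿ`, Mathlib `Polynomial.Chebyshev.C`), `n` an odd prime; the affine map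
`x ↦ 4x − 2` carries the cusps `0, 1, ∞` to the cusps `−2, 2, ∞` of `C_n`.

The INNER PERSISTENCE (hypothesis (h2) of `MenuCovering.exists_radii`) says that for distinct
`n, n'` in a geometrically growing menu the finite sets `g_n⁻¹(T)`, `g_{n'}⁻¹(T)` are DISJOINT, where
`T` is a finite set of roots of unity `≠ 1` (the persistent set of the outer power family).  Proof:
write `4y − 2 = w + w⁻¹` (`E` algebraically closed), so `4 g_n(y) − 2 = wⁿ + w⁻ⁿ`; if
`g_n(y) = ζ`, `g_{n'}(y) = ζ'` then `α := wⁿ`, `α' := w^{n'}` are roots of the quadratics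
`Z² − (4ζ−2)Z + 1`, `Z² − (4ζ'−2)Z + 1` with `α^{n'} = α'^{n}`; in a splitting field `K₁` of these
quadratics this gives `n'·h(α) = n·h(α')` for the Weil height, so EITHER `h(α) = 0` — `α` is a root
of unity, and then in `ℂ` the number `4ζ − 2 = α + ᾱ = 2 Re α ∈ [−2, 2]` is real, forcing
`ζ = ±1`, both impossible — OR the ratio `n'/n = h(α')/h(α)` is one of finitely many values,
excluded by the growth of the menu.

Contents (theorems only; no definitions — the inner map is written out):
* `chebyshevC_eval_add_inv` — `C_n(w + w⁻¹) = wⁿ + (w⁻¹)ⁿ`;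
* `inner_eval_eq`, `natDegree_inner_pos` — the inner map as the evaluation of an explicit
  polynomial of positive degree (for the localization lemma of `MenuCovering`);
* `not_torsion_chart` — `4ξ − 2 = u + u⁻¹` is impossible for roots of unity `u`, `ξ ≠ 1` (in `ℂ`,
  then in any number field);
* `inner_persistence` — the disjointness above, for `E` algebraically closed of characteristic
  zero, given a number field `K₁ ⊇ K₀` splitting the quadratics and a menu growing faster than the
  height quotients of their roots.

Classical and undisputed; nothing here bears on [IUTchIII] Cor. 3.12.
-/

noncomputable section

open NumberField Height Polynomial

namespace Summit.ABC.ABC.Theorems.GenEllTwo.MenuCovering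

/-! ## The Chebyshev identity `C_n(w + w⁻¹) = wⁿ + w⁻ⁿ` -/

section Chebyshev

variable {R : Type*} [Field R]

/-- `C_n(w + w⁻¹) = wⁿ + (w⁻¹)ⁿ` for the normalised Chebyshev polynomials `C_0 = 2`, `C_1 = X`,
`C_{n+2} = X·C_{n+1} − C_n` and `w ≠ 0`. [folklore] -/
theorem chebyshevC_eval_add_inv {w : R} (hw : w ≠ 0) :
    ∀ n : ℕ, (Polynomial.Chebyshev.C R n).eval (w + w⁻¹) = w ^ n + w⁻¹ ^ n := by
  intro n
  induction n using Nat.strong_induction_on with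
  | _ n ih =>
    rcases n with _ | n
    · simp; norm_num
    rcases n with _ | n
    · simp
    have h2 : ((n + 2 : ℕ) : ℤ) = (n : ℤ) + 2 := by push_cast; ring
    rw [h2, Polynomial.Chebyshev.C_add_two, eval_sub, eval_mul, eval_X]
    have e1 : ((n : ℤ) + 1) = ((n + 1 : ℕ) : ℤ) := by push_cast; ring
    rw [e1, ih (n + 1) (by omega), ih n (by omega)]
    have hww : w * w⁻¹ = 1 := mul_inv_cancel₀ hw
    have key : (w + w⁻¹) * (w ^ (n + 1) + w⁻¹ ^ (n + 1)) =
        (w ^ (n + 2) + w⁻¹ ^ (n + 2)) + (w ^ n + w⁻¹ ^ n) := by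
      have e2 : w * w⁻¹ ^ (n + 1) = w⁻¹ ^ n := by
        rw [pow_succ', ← mul_assoc, hww, one_mul]
      have e3 : w⁻¹ * w ^ (n + 1) = w ^ n := by
        rw [pow_succ', ← mul_assoc, inv_mul_cancel₀ hw, one_mul]
      calc (w + w⁻¹) * (w ^ (n + 1) + w⁻¹ ^ (n + 1))
          = w * w ^ (n + 1) + w * w⁻¹ ^ (n + 1) + (w⁻¹ * w ^ (n + 1) + w⁻¹ * w⁻¹ ^ (n + 1)) := by
            ring
        _ = (w ^ (n + 2) + w⁻¹ ^ (n + 2)) + (w ^ n + w⁻¹ ^ n) := by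
            rw [e2, e3]; ring
    rw [key]; ring

/-- The inner menu map `y ↦ (C_n(4y − 2) + 2)/4` is the evaluation of the polynomial
`4⁻¹·(C_n ∘ (4X − 2) + 2)`. [folklore] -/
theorem inner_eval_eq (n : ℕ) (y : R) :
    ((Polynomial.Chebyshev.C R n).eval (4 * y - 2) + 2) / 4 =
      (Polynomial.C (4⁻¹ : R) * ((Polynomial.Chebyshev.C R n).comp
        (Polynomial.C 4 * X - Polynomial.C 2) + Polynomial.C 2)).eval y := by
  simp only [eval_mul, eval_C, eval_add, eval_comp, eval_sub, eval_X]
  rw [div_eq_inv_mul]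

/-- The normalised Chebyshev polynomial `C_n` has degree `n` in characteristic zero (via
`C_n(2X) = 2·T_n(X)` and Mathlib's `natDegree_T`). [folklore] -/
theorem natDegree_chebyshevC [CharZero R] (n : ℕ) :
    (Polynomial.Chebyshev.C R n).natDegree = n := by
  have h := Polynomial.Chebyshev.C_comp_two_mul_X R n
  have hX : (2 * X : R[X]).natDegree = 1 := by
    rw [show (2 : R[X]) = Polynomial.C 2 by rfl, natDegree_C_mul (two_ne_zero)]
    exact natDegree_X
  have h1 : ((Polynomial.Chebyshev.C R n).comp (2 * X)).natDegree =
      (Polynomial.Chebyshev.C R n).natDegree := by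
    rw [natDegree_comp, hX, mul_one]
  have h2 : (2 * Polynomial.Chebyshev.T R n).natDegree = n := by
    rw [show (2 : R[X]) = Polynomial.C 2 by rfl, natDegree_C_mul (two_ne_zero)]
    rw [Polynomial.Chebyshev.natDegree_T]; simp
  rw [← h1, h, h2]

/-- The inner menu polynomial has POSITIVE degree for `n ≥ 1` (characteristic zero).
[folklore] -/
theorem natDegree_inner_pos [CharZero R] {n : ℕ} (hn : 1 ≤ n) :
    0 < (Polynomial.C (4⁻¹ : R) * ((Polynomial.Chebyshev.C R n).comp
        (Polynomial.C 4 * X - Polynomial.C 2) + Polynomial.C 2)).natDegree := by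
  have hlin : (Polynomial.C (4 : R) * X - Polynomial.C 2).natDegree = 1 := by
    rw [natDegree_sub_C, natDegree_C_mul (by norm_num)]
    exact natDegree_X
  have hcomp : ((Polynomial.Chebyshev.C R n).comp (Polynomial.C 4 * X - Polynomial.C 2)).natDegree
      = n := by
    rw [natDegree_comp, hlin, mul_one, natDegree_chebyshevC]
  have hadd : ((Polynomial.Chebyshev.C R n).comp (Polynomial.C 4 * X - Polynomial.C 2) +
      Polynomial.C 2).natDegree = n := by
    rw [natDegree_add_C, hcomp]
  rw [natDegree_C_mul (by norm_num), hadd]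
  exact hn

end Chebyshev

/-! ## The torsion obstruction: `4ξ − 2 = u + u⁻¹` with `u, ξ` roots of unity forces `ξ = 1` -/

/-- In `ℂ`: if `u` and `ξ` are roots of unity with `4ξ − 2 = u + u⁻¹`, then `ξ = 1`.
(`|u| = 1` makes `u + u⁻¹ = 2 Re u` real of absolute value `≤ 2`; so `ξ` is real, `ξ = ±1`, and
`ξ = −1` would give `|−6| ≤ 2`.) [folklore] -/
theorem eq_one_of_chart_eq_add_inv {u ξ : ℂ} {m k : ℕ} (hm : 0 < m) (hk : 0 < k)
    (hu : u ^ m = 1) (hξ : ξ ^ k = 1) (h : 4 * ξ - 2 = u + u⁻¹) : ξ = 1 := by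
  have hnu : ‖u‖ = 1 := Complex.norm_eq_one_of_pow_eq_one hu hm.ne'
  have hnξ : ‖ξ‖ = 1 := Complex.norm_eq_one_of_pow_eq_one hξ hk.ne'
  have hu0 : u ≠ 0 := by intro h0; rw [h0, norm_zero] at hnu; exact zero_ne_one hnu
  -- `u⁻¹ = conj u`
  have hinv : u⁻¹ = starRingEnd ℂ u := by
    rw [Complex.inv_def, Complex.normSq_eq_norm_sq, hnu]
    simp
  -- `u + u⁻¹ = 2 re u`, real, of absolute value ≤ 2
  have hsum : u + u⁻¹ = ((2 * u.re : ℝ) : ℂ) := by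
    rw [hinv, Complex.add_conj]
  have him : ξ.im = 0 := by
    have := congr_arg Complex.im h
    rw [hsum, Complex.ofReal_im] at this
    simpa using this
  have hre : |u.re| ≤ 1 := by
    have := Complex.abs_re_le_norm u; rw [hnu] at this; exact this
  -- `ξ` is real of norm 1: `ξ = ±1`
  have hξre : ξ = (ξ.re : ℂ) := by
    apply Complex.ext <;> simp [him]
  have habs : |ξ.re| = 1 := by
    have h1 : ‖(ξ.re : ℂ)‖ = 1 := by rw [← hξre]; exact hnξ
    rwa [Complex.norm_real, Real.norm_eq_abs] at h1
  rcases abs_eq (zero_le_one) |>.mp habs with h1 | h1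
  · rw [hξre, h1]; simp
  · -- `ξ = -1`: then `u + u⁻¹ = -6`, contradicting `|2 re u| ≤ 2`
    exfalso
    have hξv : ξ = -1 := by rw [hξre, h1]; simp
    have := congr_arg Complex.re h
    rw [hsum, Complex.ofReal_re, hξv] at this
    norm_num at this
    have hre3 : u.re = -3 := by linarith
    rw [hre3] at hre
    norm_num at hre

/-- The same obstruction in any number field `K`: if `u, ζ ∈ K` are roots of unity, `ζ ≠ 1`, then
`4ζ − 2 ≠ u + u⁻¹` (embed `K` into `ℂ`). [folklore] -/
theorem chart_ne_add_inv {K : Type*} [Field K] [NumberField K] {u ζ : K} (hu : IsOfFinOrder u)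
    (hζ : IsOfFinOrder ζ) (hζ1 : ζ ≠ 1) : 4 * ζ - 2 ≠ u + u⁻¹ := by
  intro h
  obtain ⟨m, hm, hum⟩ := isOfFinOrder_iff_pow_eq_one.mp hu
  obtain ⟨k, hk, hζk⟩ := isOfFinOrder_iff_pow_eq_one.mp hζ
  obtain ⟨φ⟩ : Nonempty (K →+* ℂ) := inferInstance
  have h' : 4 * φ ζ - 2 = φ u + (φ u)⁻¹ := by
    have := congr_arg φ h
    simpa [map_sub, map_mul, map_add, map_inv₀, map_ofNat] using this
  have := eq_one_of_chart_eq_add_inv hm hk (by rw [← map_pow, hum, map_one])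
    (by rw [← map_pow, hζk, map_one]) h'
  exact hζ1 (φ.injective (by rw [this, map_one]))

/-- From `β² − aβ + 1 = 0` and `β ≠ 0`: `a = β + β⁻¹`. [folklore] -/
private theorem eq_add_inv_of_quad {F : Type*} [Field F] {β a : F} (hβ : β ≠ 0)
    (h : β ^ 2 - a * β + 1 = 0) : a = β + β⁻¹ := by
  have : β * (β + β⁻¹) = β * a := by
    rw [mul_add, mul_inv_cancel₀ hβ]
    linear_combination h
  exact (mul_left_cancel₀ hβ this).symm

/-- The quadratic `X² − c·X + 1` is monic. [folklore] -/
private theorem monic_quad {F : Type*} [Field F] (c : F) :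
    (X ^ 2 - Polynomial.C c * X + 1 : F[X]).Monic := by
  have : (X ^ 2 - Polynomial.C c * X + 1 : F[X]) = X ^ 2 + (Polynomial.C (-c) * X + Polynomial.C 1) := by
    simp only [map_neg, map_one, neg_mul]; ring
  rw [this]
  exact monic_X_pow_add (lt_of_le_of_lt degree_linear_le (by exact_mod_cast one_lt_two))

/-! ## The inner persistence -/

section Inner

variable {K₀ : Type*} [Field K₀] [NumberField K₀]
variable {K₁ : Type*} [Field K₁] [NumberField K₁] [Algebra K₀ K₁]

/-- In a menu with growth factor `> R`, a relation `n'·A = n·B` with `0 < A, B`, `B ≤ R A`,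
`A ≤ R B` and `n ≠ n'` is impossible. [folklore] -/
private theorem ratio_lt_of_menu' {PC : Finset ℕ} {R : ℝ}
    (hgrow : ∀ p ∈ PC, ∀ p' ∈ PC, p < p' → R * p < p') {p p' : ℕ} (hp : p ∈ PC) (hp' : p' ∈ PC)
    (hne : p ≠ p') {A B : ℝ} (hA : 0 < A) (hB : 0 < B) (hAB : B ≤ R * A) (hBA : A ≤ R * B)
    (h : (p' : ℝ) * A = p * B) : False := by
  rcases lt_or_gt_of_ne hne with hlt | hlt
  · have h1 : R * p * A < p' * A := mul_lt_mul_of_pos_right (hgrow p hp p' hp' hlt) hA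
    have h2 : (p : ℝ) * B ≤ p * (R * A) := mul_le_mul_of_nonneg_left hAB (Nat.cast_nonneg _)
    nlinarith
  · have h1 : R * p' * B < p * B := mul_lt_mul_of_pos_right (hgrow p' hp' p hp hlt) hB
    have h2 : (p' : ℝ) * A ≤ p' * (R * B) := mul_le_mul_of_nonneg_left hBA (Nat.cast_nonneg _)
    nlinarith

/-- **INNER PERSISTENCE of the conjugated Chebyshev family** (hypothesis (h2) of
`MenuCovering.exists_radii` for `g_n : y ↦ (C_n(4y − 2) + 2)/4`).  Data: a number field `K₀`, a
finite set `T ⊂ K₀` of roots of unity `≠ 1`; a number field `K₁ ⊇ K₀` in which every quadratic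
`Z² − (4ζ−2)Z + 1`, `ζ ∈ T`, splits; `R` dominating the quotients of positive Weil heights of the
roots of these quadratics in `K₁`; a menu `PC` of primes with growth factor `> R`.  Then for `E`
algebraically closed of characteristic zero, `τ : K₀ →+* E`, `y ∈ E` and distinct `n, n' ∈ PC`,
the values `g_n(y)` and `g_{n'}(y)` cannot BOTH lie in `τ(T)`. [cite: MochizukiGenEll2010, Thm 2.1 p.12] -/
theorem inner_persistence (T : Finset K₀) (hT : ∀ ζ ∈ T, IsOfFinOrder ζ ∧ ζ ≠ 1)
    (hsplit : ∀ ζ ∈ T, ((X ^ 2 - Polynomial.C (4 * ζ - 2) * X + 1 : K₀[X]).map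
      (algebraMap K₀ K₁)).Splits)
    {R : ℝ} (hR : ∀ β β' : K₁,
      (∃ ζ ∈ T, β ^ 2 - algebraMap K₀ K₁ (4 * ζ - 2) * β + 1 = 0) →
      (∃ ζ ∈ T, β' ^ 2 - algebraMap K₀ K₁ (4 * ζ - 2) * β' + 1 = 0) →
        0 < logHeight₁ β' → logHeight₁ β ≤ R * logHeight₁ β')
    {PC : Finset ℕ} (hprime : ∀ n ∈ PC, n.Prime)
    (hgrow : ∀ n ∈ PC, ∀ n' ∈ PC, n < n' → R * n < n')
    {E : Type*} [Field E] [CharZero E] [IsAlgClosed E] (τ : K₀ →+* E)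
    {n n' : ℕ} (hn : n ∈ PC) (hn' : n' ∈ PC) (hne : n ≠ n') {y : E}
    (hy : ((Polynomial.Chebyshev.C E n).eval (4 * y - 2) + 2) / 4 ∈ τ '' (T : Set K₀))
    (hy' : ((Polynomial.Chebyshev.C E n').eval (4 * y - 2) + 2) / 4 ∈ τ '' (T : Set K₀)) :
    False := by
  obtain ⟨ζ, hζ, hyζ⟩ := hy
  obtain ⟨ζ', hζ', hyζ'⟩ := hy'
  have hnP : n.Prime := hprime n hn
  have hnP' : n'.Prime := hprime n' hn'
  -- `w` with `w² − (4y − 2) w + 1 = 0`, so `w ≠ 0` and `4y − 2 = w + w⁻¹`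
  obtain ⟨d, hd⟩ := IsAlgClosed.exists_pow_nat_eq ((4 * y - 2) ^ 2 - 4) two_pos
  set w : E := ((4 * y - 2) + d) / 2 with hwdef
  have hw : w ^ 2 - (4 * y - 2) * w + 1 = 0 := by
    rw [hwdef]
    field_simp
    linear_combination hd
  have hw0 : w ≠ 0 := by
    intro h0; rw [h0] at hw; norm_num at hw
  have hsum : 4 * y - 2 = w + w⁻¹ := eq_add_inv_of_quad hw0 hw
  -- `α := wⁿ`, `α' := w^{n'}` are roots of the mapped quadratics
  have hC : ∀ m : ℕ, (Polynomial.Chebyshev.C E m).eval (4 * y - 2) = w ^ m + w⁻¹ ^ m := by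
    intro m; rw [hsum]; exact chebyshevC_eval_add_inv hw0 m
  have hpow : ∀ m : ℕ, (w ^ m) ^ 2 - (w ^ m + w⁻¹ ^ m) * w ^ m + 1 = 0 := by
    intro m
    have : w⁻¹ ^ m * w ^ m = 1 := by rw [← mul_pow, inv_mul_cancel₀ hw0, one_pow]
    linear_combination -this
  have hα : (w ^ n) ^ 2 - τ (4 * ζ - 2) * w ^ n + 1 = 0 := by
    have e1 : τ (4 * ζ - 2) = w ^ n + w⁻¹ ^ n := by
      rw [← hC n, map_sub, map_mul, map_ofNat, hyζ, map_ofNat]; ring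
    rw [e1]; exact hpow n
  have hα' : (w ^ n') ^ 2 - τ (4 * ζ' - 2) * w ^ n' + 1 = 0 := by
    have e1 : τ (4 * ζ' - 2) = w ^ n' + w⁻¹ ^ n' := by
      rw [← hC n', map_sub, map_mul, map_ofNat, hyζ', map_ofNat]; ring
    rw [e1]; exact hpow n'
  -- extend `τ` to `ψ : K₁ → E`
  letI : Algebra K₀ E := τ.toAlgebra
  let ψ : K₁ →ₐ[K₀] E := IsAlgClosed.lift
  have hψ : ∀ x : K₀, ψ (algebraMap K₀ K₁ x) = τ x := fun x => by
    rw [AlgHom.commutes]; rfl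
  -- the roots of the mapped quadratic in `E` are `ψ`-images of its roots in `K₁`
  have hroots : ∀ ζ ∈ T, ∀ α : E, α ^ 2 - τ (4 * ζ - 2) * α + 1 = 0 →
      ∃ β : K₁, β ^ 2 - algebraMap K₀ K₁ (4 * ζ - 2) * β + 1 = 0 ∧ ψ β = α := by
    intro ζ hζ α hαr
    set q : K₀[X] := X ^ 2 - Polynomial.C (4 * ζ - 2) * X + 1 with hq
    have hs := hsplit ζ hζ
    have hmap : (q.map (algebraMap K₀ K₁)).map (ψ : K₁ →+* E) = q.map τ := by
      rw [Polynomial.map_map]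
      congr 1
      ext x; exact hψ x
    have hq0 : q.map τ ≠ 0 := ((monic_quad (4 * ζ - 2)).map τ).ne_zero
    have hαroot : α ∈ (q.map τ).roots := by
      rw [mem_roots hq0, IsRoot.def, hq]
      simp only [Polynomial.map_add, Polynomial.map_sub, Polynomial.map_pow, map_X,
        Polynomial.map_mul, map_C, Polynomial.map_one, eval_add, eval_sub, eval_pow, eval_X,
        eval_mul, eval_C, eval_one]
      exact hαr
    rw [← hmap, hs.roots_map (ψ : K₁ →+* E), Multiset.mem_map] at hαroot
    obtain ⟨β, hβ, hβα⟩ := hαroot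
    refine ⟨β, ?_, hβα⟩
    have hq1 : q.map (algebraMap K₀ K₁) ≠ 0 :=
      ((monic_quad (4 * ζ - 2)).map (algebraMap K₀ K₁)).ne_zero
    have := (mem_roots hq1).mp hβ
    rw [IsRoot.def, hq] at this
    simpa only [Polynomial.map_add, Polynomial.map_sub, Polynomial.map_pow, map_X,
      Polynomial.map_mul, map_C, Polynomial.map_one, eval_add, eval_sub, eval_pow, eval_X,
      eval_mul, eval_C, eval_one] using this
  obtain ⟨β, hβ, hβα⟩ := hroots ζ hζ (w ^ n) hα
  obtain ⟨β', hβ', hβα'⟩ := hroots ζ' hζ' (w ^ n') hα'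
  -- `β^{n'} = β'^{n}` in `K₁`
  have hrel : β ^ n' = β' ^ n := by
    apply (ψ : K₁ →+* E).injective
    rw [map_pow, map_pow]
    change ψ β ^ n' = ψ β' ^ n
    rw [hβα, hβα', ← pow_mul, ← pow_mul, mul_comm]
  have hβ0 : β ≠ 0 := by
    intro h0; rw [h0] at hβ; norm_num at hβ
  have hβ'0 : β' ≠ 0 := by
    intro h0; rw [h0] at hβ'; norm_num at hβ'
  -- heights: `n' h(β) = n h(β')`
  have hh : (n' : ℝ) * logHeight₁ β = n * logHeight₁ β' := by
    rw [← logHeight₁_pow, ← logHeight₁_pow, hrel]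
  by_cases hzero : logHeight₁ β = 0
  · -- `β` is a root of unity (Kronecker): contradiction with `4ζ − 2 = β + β⁻¹` read in `ℂ`
    have hβtor : IsOfFinOrder β :=
      (Literature.NumberTheory.DiophantineGeometry.logHeight₁_eq_zero_iff_isOfFinOrder hβ0).mp
        hzero
    have hζ₁tor : IsOfFinOrder (algebraMap K₀ K₁ ζ) := by
      obtain ⟨m, hm, hmζ⟩ := isOfFinOrder_iff_pow_eq_one.mp (hT ζ hζ).1
      exact isOfFinOrder_iff_pow_eq_one.mpr ⟨m, hm, by rw [← map_pow, hmζ, map_one]⟩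
    have hζ₁ne : algebraMap K₀ K₁ ζ ≠ 1 := by
      intro h1
      exact (hT ζ hζ).2 ((algebraMap K₀ K₁).injective (by rw [h1, map_one]))
    refine chart_ne_add_inv hβtor hζ₁tor hζ₁ne ?_
    have e : algebraMap K₀ K₁ (4 * ζ - 2) = 4 * algebraMap K₀ K₁ ζ - 2 := by
      rw [map_sub, map_mul, map_ofNat, map_ofNat]
    rw [← e]
    exact eq_add_inv_of_quad hβ0 hβ
  · have hA : 0 < logHeight₁ β := lt_of_le_of_ne (zero_le_logHeight₁ β) (Ne.symm hzero)
    have hB : 0 < logHeight₁ β' := by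
      have : 0 < (n' : ℝ) * logHeight₁ β := mul_pos (by exact_mod_cast hnP'.pos) hA
      rw [hh] at this
      exact pos_of_mul_pos_right this (Nat.cast_nonneg _)
    exact ratio_lt_of_menu' hgrow hn hn' hne hA hB
      (hR β' β ⟨ζ', hζ', hβ'⟩ ⟨ζ, hζ, hβ⟩ hA) (hR β β' ⟨ζ, hζ, hβ⟩ ⟨ζ', hζ', hβ'⟩ hB) hh

end Inner

end Summit.ABC.ABC.Theorems.GenEllTwo.MenuCovering

end
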